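import Mathlib.LinearAlgebra.Span.Basic
import Mathlib.Algebra.Module.Equiv.Basic
import Mathlib.Tactic.Ring
import HarnessLib

/-!
# The tame type dichotomy as linear algebra: Frobenius conjugating the inertia generator to its inverse leaves no common eigenline (supercuspidal), commuting with it preserves the eigenlines (principal series) (cell `b2b-bsdres`, seat additive-p4 gen 43, memo V76 §4 — K127)

HONEST FRAMING (verbatim, cell `b2b-bsdres`): the goal of the cell is to DELETE the COMBINATION-SHAPED
residual classes for ALL analytic-rank `≤ 1` curves over `ℚ` — "full BSD formula for every rank `≤ 1`
curve in class `C`" assembled STRICTLY from published theorems — so that the rank-`≤ 1` remainder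
becomes exactly the CONSTRUCTION-SHAPED classes, which are TYPED (missing-input Props), NOT attempted;
this is not "finishing BSD". This file: TOOL theorems (pure linear algebra; 0 defs, 0 facts, nothing
booked; X4 stays CONSTRUCTION-shaped; no mark moves).

## Why

The END-STATE notes of the additive-certificate residue (TWIST-ROWS-ENDSTATE §4, III-ROWS-ENDSTATE §6)
carried three `p ≥ 5` rows (11760bb1 @7, 15050bb1 @5, 18150da1 @11) whose LOCAL TYPE at the additive
prime was undecided ("principal series with a character of order 3, 4 or 6, or supercuspidal"). For an
elliptic curve with potentially good, TAME reduction at `p ≥ 5` the inertia group acts on the `ℓ`-adic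
(or Weil–Deligne) representation through a cyclic group of order `e = 12/gcd(12, v_p(Δ_min))` generated
by an element `g` of determinant `1`, i.e. with eigenvalues `ζ, ζ⁻¹`, `ζ` of exact order `e`; and a
Frobenius `φ` normalises inertia with `φ g φ⁻¹ = g^p` (structure of the tame Galois group). Hence:
`p ≡ 1 (mod e)` ⟹ `φ` COMMUTES with `g` ⟹ the `ζ`-eigenline of `g` is `φ`-stable ⟹ the Weil
representation is a sum of two characters = ramified PRINCIPAL SERIES; `p ≡ −1 (mod e)` with `e > 2`
⟹ `φ g = g⁻¹ φ` ⟹ NO common eigenvector (a common eigenvector with `g`-eigenvalue `c` forces `c = c⁻¹`)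
⟹ the representation is IRREDUCIBLE = SUPERCUSPIDAL (depth zero, induced from the unramified quadratic
extension). Instrument E21 (memo V76 §4) computed `e = 3` on all three rows from Cremona's minimal models,
so 11760bb1 @7 (`7 ≡ 1 mod 3`) is principal series and 15050bb1 @5, 18150da1 @11 (`5, 11 ≡ −1 mod 3`)
are supercuspidal of the 'θ' shape of the six `p = 3` rows (there `e = 4`, `3 ≡ −1 mod 4`). This file is
the linear algebra of the two implications, for any field `k`, `k`-space `V`, automorphism `g` and
injective endomorphism `φ`:

* `inv_smul_of_eigenvector` — bookkeeping: `g v = c • v`, `v ≠ 0` ⟹ `c ≠ 0` and `g⁻¹ v = c⁻¹ • v`;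
* `sq_eq_one_of_common_eigenvector` — **SC branch**: if `φ (g v) = g⁻¹ (φ v)` for all `v` and `v ≠ 0` is
  a common eigenvector (`g v = c • v`, `φ v = d • v`) then `c² = 1`;
* `not_mem_span_of_sq_ne_one` — hence for a `g`-eigenvector `v` with `c² ≠ 1`, `φ v ∉ k ∙ v`: the
  eigenline is NOT `φ`-stable (and the two eigenlines are the only `g`-stable lines when `ζ ≠ ζ⁻¹`), i.e.
  no line is stable under both — irreducibility of the `2`-dimensional representation;
* `exists_eigenvalue_of_mem_span`, `no_common_stable_line` — a `g`-stable line is an eigenline, so under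
  `φ g = g⁻¹ φ` and "every eigenvalue `c` of `g` has `c² ≠ 1`" NO line is stable under both `g` and `φ`;
* `smul_apply_of_commute` / `map_ker_sub_smul_le_of_commute` — **PS branch**: if `φ` commutes with `g`
  then `φ` maps `g`-eigenvectors to `g`-eigenvectors with the same eigenvalue, so the full `c`-eigenspace
  `ker(g − c)` is `φ`-stable; when it is a line (`c = ζ` simple, `ζ ≠ ζ⁻¹`) that line is a common stable
  line: the representation is reducible — a principal series.

No number theory enters; the dictionary (`g` = image of a tame inertia generator, `φ` = Frobenius,
`c = ζ_e`, `c² ≠ 1 ⟺ e ∤ 2`, `φgφ⁻¹ = g^p` with `g^p = g` resp. `g⁻¹` according as `p ≡ ±1 (mod e)`)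
and the values of `e` are displayed in memo V76 §4 / E21, not here.

## References (context for the dictionary only)

* J.-P. Serre, «Propriétés galoisiennes des points d'ordre fini des courbes elliptiques», Invent. Math. 15
  (1972), §1 (tame inertia; `Frob σ Frob⁻¹ = σ^p`) and §5.6 (the exponent `e = 12/gcd(12, v(Δ))`). [cite: Serre1972, §1.3]
* A. Kraus, «Sur le défaut de semi-stabilité des courbes elliptiques à réduction additive», Manuscripta
  Math. 69 (1990) — the semistability defect at `p ≥ 5`.
-/

namespace Summit.BirchSwinnertonDyer.Rank1Residual.LocalType

variable {k V : Type*} [Field k] [AddCommGroup V] [Module k V]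

/-- Bookkeeping: an eigenvector `v ≠ 0` of the automorphism `g` with eigenvalue `c` has `c ≠ 0` and is an
eigenvector of `g⁻¹` with eigenvalue `c⁻¹`. -/
theorem inv_smul_of_eigenvector (g : V ≃ₗ[k] V) {v : V} (hv : v ≠ 0) {c : k} (hg : g v = c • v) :
    c ≠ 0 ∧ g.symm v = c⁻¹ • v := by
  have hc : c ≠ 0 := by
    rintro rfl
    rw [zero_smul] at hg
    exact hv (g.injective (by rw [hg, map_zero]))
  refine ⟨hc, ?_⟩
  have h := congrArg g.symm hg
  rw [LinearEquiv.symm_apply_apply, map_smul] at h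
  -- h : v = c • g.symm v
  calc g.symm v = c⁻¹ • (c • g.symm v) := by rw [smul_smul, inv_mul_cancel₀ hc, one_smul]
    _ = c⁻¹ • v := by rw [← h]

/-- **SC branch.** If Frobenius conjugates the inertia generator to its inverse — `φ (g v) = g⁻¹ (φ v)` —
and `φ` is injective, then a COMMON eigenvector `v ≠ 0` (`g v = c • v`, `φ v = d • v`) forces `c² = 1`.
So when the inertial eigenvalues are `ζ^{±1}` with `ζ² ≠ 1` (`e > 2`) there is no common eigenvector. -/
theorem sq_eq_one_of_common_eigenvector (g : V ≃ₗ[k] V) (φ : V →ₗ[k] V) (hφ : Function.Injective φ)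
    (hconj : ∀ v, φ (g v) = g.symm (φ v)) {v : V} (hv : v ≠ 0) {c d : k}
    (hg : g v = c • v) (hφv : φ v = d • v) : c ^ 2 = 1 := by
  obtain ⟨hc, hginv⟩ := inv_smul_of_eigenvector g hv hg
  have hd : d ≠ 0 := by
    rintro rfl
    rw [zero_smul] at hφv
    exact hv (hφ (by rw [hφv, map_zero]))
  have h1 : φ (g v) = (c * d) • v := by rw [hg, map_smul, hφv, smul_smul]
  have h2 : g.symm (φ v) = (d * c⁻¹) • v := by rw [hφv, map_smul, hginv, smul_smul]
  have h3 : (c * d) • v = (d * c⁻¹) • v := by rw [← h1, ← h2, hconj]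
  have h4 : c * d = d * c⁻¹ := by
    have := sub_eq_zero.mpr h3
    rw [← sub_smul, smul_eq_zero] at this
    rcases this with h | h
    · exact sub_eq_zero.mp h
    · exact absurd h hv
  have h5 : (c * c) * d = 1 * d := by
    calc (c * c) * d = (c * d) * c := by ring
      _ = (d * c⁻¹) * c := by rw [h4]
      _ = 1 * d := by rw [mul_assoc, inv_mul_cancel₀ hc, mul_one, one_mul]
  rw [sq, mul_right_cancel₀ hd h5]

/-- Hence, in the SC branch, the eigenline of a `g`-eigenvector `v` with `c² ≠ 1` is NOT `φ`-stable:
`φ v ∉ k ∙ v`. (Together with: the only `g`-stable lines are the two eigenlines when `ζ ≠ ζ⁻¹` — this is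
the irreducibility of the `2`-dimensional Weil representation, i.e. supercuspidality.) -/
theorem not_mem_span_of_sq_ne_one (g : V ≃ₗ[k] V) (φ : V →ₗ[k] V) (hφ : Function.Injective φ)
    (hconj : ∀ v, φ (g v) = g.symm (φ v)) {v : V} (hv : v ≠ 0) {c : k}
    (hg : g v = c • v) (hc : c ^ 2 ≠ 1) : φ v ∉ k ∙ v := by
  intro hmem
  obtain ⟨d, hd⟩ := Submodule.mem_span_singleton.mp hmem
  exact hc (sq_eq_one_of_common_eigenvector g φ hφ hconj hv hg hd.symm)

/-- A `g`-stable line through `v ≠ 0` is an eigenline: `g v ∈ k ∙ v` gives an eigenvalue. (So "no common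
eigenvector" is the same as "no line stable under both `g` and `φ`".) -/
theorem exists_eigenvalue_of_mem_span (g : V →ₗ[k] V) {v : V} (hgv : g v ∈ k ∙ v) :
    ∃ c : k, g v = c • v := by
  obtain ⟨c, hc⟩ := Submodule.mem_span_singleton.mp hgv
  exact ⟨c, hc.symm⟩

/-- **SC branch, line form.** Under `φ g = g⁻¹ φ` with `φ` injective: if every eigenvalue `c` of `g` has
`c² ≠ 1`, then NO line `k ∙ v` (`v ≠ 0`) is stable under both `g` and `φ`. -/
theorem no_common_stable_line (g : V ≃ₗ[k] V) (φ : V →ₗ[k] V) (hφ : Function.Injective φ)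
    (hconj : ∀ v, φ (g v) = g.symm (φ v))
    (hev : ∀ (c : k) (w : V), w ≠ 0 → g w = c • w → c ^ 2 ≠ 1)
    {v : V} (hv : v ≠ 0) (hgv : g v ∈ k ∙ v) (hφv : φ v ∈ k ∙ v) : False := by
  obtain ⟨c, hc⟩ := exists_eigenvalue_of_mem_span (g : V →ₗ[k] V) hgv
  exact not_mem_span_of_sq_ne_one g φ hφ hconj hv hc (hev c v hv hc) hφv

/-- **PS branch.** If `φ` commutes with `g` then `φ` maps a `g`-eigenvector with eigenvalue `c` to a
`g`-eigenvector with eigenvalue `c` (possibly zero). -/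
theorem smul_apply_of_commute (g φ : V →ₗ[k] V) (hcomm : ∀ v, φ (g v) = g (φ v)) {v : V} {c : k}
    (hg : g v = c • v) : g (φ v) = c • φ v := by
  rw [← hcomm, hg, map_smul]

/-- **PS branch, subspace form.** If `φ` commutes with `g`, the full `c`-eigenspace
`{w | g w = c • w}` (as the kernel of `g − c`) is `φ`-stable; in particular when it is a line (the
eigenvalue `c = ζ` is simple, `ζ ≠ ζ⁻¹`) that line is a common stable line: the representation is
reducible — a principal series. -/
theorem map_ker_sub_smul_le_of_commute (g φ : V →ₗ[k] V) (hcomm : ∀ v, φ (g v) = g (φ v)) (c : k) :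
    (LinearMap.ker (g - c • LinearMap.id)).map φ ≤ LinearMap.ker (g - c • LinearMap.id) := by
  rintro _ ⟨w, hw, rfl⟩
  rw [SetLike.mem_coe, LinearMap.mem_ker, LinearMap.sub_apply, LinearMap.smul_apply,
    LinearMap.id_apply, sub_eq_zero] at hw
  rw [LinearMap.mem_ker, LinearMap.sub_apply, LinearMap.smul_apply, LinearMap.id_apply, sub_eq_zero]
  exact smul_apply_of_commute g φ hcomm hw

end Summit.BirchSwinnertonDyer.Rank1Residual.LocalType
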